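import Mathlib
import Summits.NavierStokesRegularity.NavierStokesRegularity.Theorems.SubOnsagerCeilingKPSideBranchClassDynamics
import HarnessLib

/-!
# IN-SHELL PUMP LADDERS: the Katz–Pavlović chain at scale ratio `(1+ε₀)^{1/4}` sits inside the KP class at
# ratio `1+ε₀` (helper file for crux stmt-NavierStokesRegularity-27057 `SubOnsagerCeiling.ForwardTailCeilingKP`,
# `--supports … --as helper`)

THE LADDER CLASS (def-free, by coefficient hypotheses on a KP network proper `α`: symmetric (4.2), cancelling
(4.3), orthant, diagonal feeds): in-shell Katz–Pavlović PUMPS `0 → 1` (weight `P₀`), `1 → 2` (weight `P₁`),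
`2 → 3` (weight `P₂`) and ONE forward feed `3 → 0` (weight `f`) one shell up; no other feed, no differential
in-shell triad.  Writing `Λₙ = (1+ε₀)^{5n/2}`, the closed form of the nonlinearity (`pumpLadder_quadTerm_*`) is

  `quadTerm₀(n) = fΛ_{n-1}x²_{3,n-1} − P₀Λₙx_{0,n}x_{1,n}`,   `quadTerm₁(n) = P₀Λₙx²_{0,n} − P₁Λₙx_{1,n}x_{2,n}`,
  `quadTerm₂(n) = P₁Λₙx²_{1,n} − P₂Λₙx_{2,n}x_{3,n}`,        `quadTerm₃(n) = P₂Λₙx²_{2,n} − fΛₙx_{3,n}x_{0,n+1}`: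

along the SITES `m = 4n + j ↦ (j, n)` the table's equations of motion ARE the positive Katz–Pavlović chain
`ż_m = c_{m-1} z²_{m-1} − c_m z_m z_{m+1}` with bond coefficients `c_{4n+j} = w_j Λₙ`, `w = (P₀, P₁, P₂, f)`
(`pumpLadder_chain_step`: the out-coefficient of every site is the in-coefficient of the next).  With the TUNED
weights `w_j = c·(1+ε₀)^{5j/8}` the bond coefficients are `c_m = c·B^{5m/2}`, `B = (1+ε₀)^{1/4}`: EXACTLY the chain
the LEAD lineage certifies slice by slice (`Theorems/SubOnsagerCeilingDyadicRangeChain.lean` &c.), at the scale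
ratio `B = (1+ε₀)^{1/4}` instead of `1+ε₀` (`pumpLadder_tuned_coeff`).  (Two- and three-mode ladders give the
ratios `(1+ε₀)^{1/2}`, `(1+ε₀)^{1/3}` in the same way.)

THE GRADING LEMMA (`pumpLadder_primary_two_or_three`): in ANY grading `lev` of the modes obeying the structural
clauses `GradedStruct α lev` of the registered stubs (skeleton `Cruxes/ForwardTailCeilingKP/Lines/kp_shell_barrier.lean`
v6–v19, verbatim below), mode `2` or mode `3` has level `0`: the only forward source is `3`; if it is not primary,
its in-shell pump partner `2` and the pump partner `1` of its target `0` must be primary.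

CONSEQUENCE (`pumpLadder_chainBarrier_of_primaryGraded`): the body of `PrimaryGradedAt R ε₀ α` (verbatim) for a
ladder table yields `θ ∈ (1/2, 1]`, `D ≥ 0` and a ladder mode `j ∈ {2, 3}` with the ν-UNIFORM weighted shell barrier
`(1+ε₀)^{2θn}·½x_{j,n}(t)² ≤ D·E₀` along every honest non-negative viscous solution — i.e. the super-critical
barrier `B^{2θ(m-j)}·½z_m² ≤ D·E₀` for the embedded chain at ratio `B = (1+ε₀)^{1/4}` on the residue class
`m ≡ j (mod 4)` of sites (viscosity profile `ν B^{8⌊m/4⌋}`, within the factor `B^{-6} ∈ [2^{-3/2}, 1]` of the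
standard `ν B^{2m}`).

READING FOR THE CENSUS (the point of this file).  The registered stub `stub_primaryGradedLargeRatio` quantifies
over ALL KP networks proper at EVERY `ε₀ ∈ (1/4, 1]`; applied to the tuned ladders it contains the λ-uniform
super-critical barrier for the positive Katz–Pavlović chain at every ratio `B ∈ ((5/4)^{1/4}, 2^{1/4}] ≈ (1.057, 1.189]`
(and `(1.077, 1.26]`, `(1.118, 1.414]` from the shorter ladders) — the regime where the chain-front census of hand
leafhand-4-g0 (CHAIN-FRONT-CENSUS-leafhand4-g0.md on the item) measures the smallest margin (`θ_eff ≈ 0.60` at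
`B ≈ 1.10`) and where no certified region exists (LEAD census v15: the descent of regions ends near `b ≈ 1.36`;
«5/4 needs depth 4»).  So the split of the stubs at `ε₀ = 1/4` does NOT separate the chain regimes: STUB 1 is not
closed by descending the chain corner to `b = 5/4`; its chain content reaches down to ratio `1.057`, and even the
single ratio `ε₀ = 1` contains the chain at `2^{1/4}`.  (The companion file `…KPPumpLadderWitness.lean` shows the
tuned ladders are admissible tables of `E₂(8)` — orthant, diagonal feeds — at every `ε₀ ∈ (0, 1]`.)

HONEST FRAMING: algebra and bookkeeping about Tao-type MODEL lattice tables (rung TL-M2Break, route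
SubOnsagerCeiling); no stub, crux or summit is proved or refuted; nothing here bears on Navier–Stokes regularity.
[cite: Tao2016AveragedNS, §4 (4.2)–(4.3), (4.13)] [cite: BarbatoMorandinRomito2011, §3.2 (shape of the barrier)]
-/

noncomputable section

-- the sub-problem namespace `NavierStokesRegularity.NavierStokesRegularity` is the tree's layout (D-0017)
set_option linter.dupNamespace false

namespace Summit.NavierStokesRegularity.NavierStokesRegularity.Theorems

open Set Finset
open Literature.Analysis.FluidPDE.TaoCascade

section PumpLadder

variable {α : Fin 4 → Fin 4 → Fin 4 → ℤ × ℤ × ℤ → ℝ} {P₀ P₁ P₂ f : ℝ}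

/-! ## §1 Closed-form dynamics of the ladder class -/

/-- In the ladder class every in-shell coefficient `α a b i (0,0,0)` is explicit: the pump weights `P₀, P₁, P₂`
at `(0,0,1)`, `(1,1,2)`, `(2,2,3)`, their Katz–Pavlović back-reactions `−P_j/2`, and `0` elsewhere
((4.2)–(4.3)). [this file] -/
theorem pumpLadder_coeff (hs : IsSymmetricCoeff α) (hc : IsCancellingCoeff α)
    (hP : ∀ a c : Fin 4, a ≠ c → α a a c (0, 0, 0) =
      (if a = 0 ∧ c = 1 then P₀ else 0) + (if a = 1 ∧ c = 2 then P₁ else 0) + (if a = 2 ∧ c = 3 then P₂ else 0))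
    (hCz : ∀ a b c : Fin 4, a ≠ b → a ≠ c → b ≠ c → α a b c (0, 0, 0) = 0) (a b i : Fin 4) :
    α a b i (0, 0, 0) =
      (if a = 0 ∧ b = 0 ∧ i = 1 then P₀ else 0) + (if a = 1 ∧ b = 1 ∧ i = 2 then P₁ else 0) +
        (if a = 2 ∧ b = 2 ∧ i = 3 then P₂ else 0) +
        (if (a = 0 ∧ b = 1 ∧ i = 0) ∨ (a = 1 ∧ b = 0 ∧ i = 0) then -P₀ / 2 else 0) +
        (if (a = 1 ∧ b = 2 ∧ i = 1) ∨ (a = 2 ∧ b = 1 ∧ i = 1) then -P₁ / 2 else 0) +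
        (if (a = 2 ∧ b = 3 ∧ i = 2) ∨ (a = 3 ∧ b = 2 ∧ i = 2) then -P₂ / 2 else 0) := by
  have hdiag : ∀ e : Fin 4, α e e e (0, 0, 0) = 0 := fun e => kpProper_inShell_diag_zero hc e
  have hback : ∀ e j : Fin 4, e ≠ j → α e j e (0, 0, 0) = -(α e e j (0, 0, 0)) / 2 := by
    intro e j hej
    have h1 := kpProper_inShell_back hc e j
    have h2 : α j e e (0, 0, 0) = α e j e (0, 0, 0) := hs j e e 0 0 0 kpProper_mem000
    linarith
  have hback' : ∀ e j : Fin 4, e ≠ j → α j e e (0, 0, 0) = -(α e e j (0, 0, 0)) / 2 := by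
    intro e j hej
    rw [hs j e e 0 0 0 kpProper_mem000, hback e j hej]
  fin_cases a <;> fin_cases b <;> fin_cases i <;>
    first
      | (rw [hdiag]; simp (config := { decide := true }))
      | (rw [hCz _ _ _ (by decide) (by decide) (by decide)]; simp (config := { decide := true }))
      | (rw [hP _ _ (by decide)]; simp (config := { decide := true }))
      | (rw [hback _ _ (by decide), hP _ _ (by decide)]; simp (config := { decide := true }))
      | (rw [hback' _ _ (by decide), hP _ _ (by decide)]; simp (config := { decide := true }))

/-- Closed form of the in-shell sum into component `i` in the ladder class: the three pumps and their
back-reactions. [this file] -/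
theorem pumpLadder_inShell (hs : IsSymmetricCoeff α) (hc : IsCancellingCoeff α)
    (hP : ∀ a c : Fin 4, a ≠ c → α a a c (0, 0, 0) =
      (if a = 0 ∧ c = 1 then P₀ else 0) + (if a = 1 ∧ c = 2 then P₁ else 0) + (if a = 2 ∧ c = 3 then P₂ else 0))
    (hCz : ∀ a b c : Fin 4, a ≠ b → a ≠ c → b ≠ c → α a b c (0, 0, 0) = 0)
    (y : Fin 4 → ℝ) (i : Fin 4) :
    ∑ a, ∑ b, α a b i (0, 0, 0) * (y a * y b) =
      (if i = 1 then P₀ * (y 0 * y 0) else 0) + (if i = 2 then P₁ * (y 1 * y 1) else 0) +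
        (if i = 3 then P₂ * (y 2 * y 2) else 0) -
        (if i = 0 then P₀ * (y 0 * y 1) else 0) - (if i = 1 then P₁ * (y 1 * y 2) else 0) -
        (if i = 2 then P₂ * (y 2 * y 3) else 0) := by
  fin_cases i
  all_goals simp (config := { decide := true }) [Fin.sum_univ_four, pumpLadder_coeff hs hc hP hCz]
  all_goals ring

/-- **Ladder site `(0,n)`**: `quadTerm₀(n) = fΛ_{n-1}x²_{3,n-1} − P₀Λₙx_{0,n}x_{1,n}` — fed across the shell by the
top of the previous rung, drained in-shell by the first pump. [this file] -/
theorem pumpLadder_quadTerm_zero (hs : IsSymmetricCoeff α) (hc : IsCancellingCoeff α)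
    (hO : ∀ (Y : Fin 4 → ℤ → ℝ → ℝ) (τ : ℝ), (∀ (j : Fin 4) (k : ℤ), 1 ≤ k → 0 ≤ Y j k τ) →
      ∀ δ : ℝ, 0 < δ → ∀ (i : Fin 4) (n : ℤ), 1 ≤ n → Y i n τ = 0 → 0 ≤ quadTerm δ α Y i n τ)
    (hD : ∀ a b i : Fin 4, a ≠ b → α a b i (0, 0, 1) = 0)
    (hw : ∀ a c : Fin 4, α a a c (0, 0, 1) = if a = 3 ∧ c = 0 then f else 0)
    (hP : ∀ a c : Fin 4, a ≠ c → α a a c (0, 0, 0) =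
      (if a = 0 ∧ c = 1 then P₀ else 0) + (if a = 1 ∧ c = 2 then P₁ else 0) + (if a = 2 ∧ c = 3 then P₂ else 0))
    (hCz : ∀ a b c : Fin 4, a ≠ b → a ≠ c → b ≠ c → α a b c (0, 0, 0) = 0)
    (ε₀ : ℝ) (X : Fin 4 → ℤ → ℝ → ℝ) (n : ℤ) (t : ℝ) :
    quadTerm ε₀ α X 0 n t =
      f * (1 + ε₀) ^ ((5 : ℝ) * ((n : ℝ) - 1) / 2) * X 3 (n - 1) t ^ 2 -
        P₀ * (1 + ε₀) ^ ((5 : ℝ) * n / 2) * (X 0 n t * X 1 n t) := by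
  rw [kpProper_quadTerm hs hc hO hD, pumpLadder_inShell hs hc hP hCz (fun j => X j n t) 0]
  simp [hw]
  ring

/-- **Ladder site `(1,n)`**: `quadTerm₁(n) = P₀Λₙx²_{0,n} − P₁Λₙx_{1,n}x_{2,n}`. [this file] -/
theorem pumpLadder_quadTerm_one (hs : IsSymmetricCoeff α) (hc : IsCancellingCoeff α)
    (hO : ∀ (Y : Fin 4 → ℤ → ℝ → ℝ) (τ : ℝ), (∀ (j : Fin 4) (k : ℤ), 1 ≤ k → 0 ≤ Y j k τ) →
      ∀ δ : ℝ, 0 < δ → ∀ (i : Fin 4) (n : ℤ), 1 ≤ n → Y i n τ = 0 → 0 ≤ quadTerm δ α Y i n τ)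
    (hD : ∀ a b i : Fin 4, a ≠ b → α a b i (0, 0, 1) = 0)
    (hw : ∀ a c : Fin 4, α a a c (0, 0, 1) = if a = 3 ∧ c = 0 then f else 0)
    (hP : ∀ a c : Fin 4, a ≠ c → α a a c (0, 0, 0) =
      (if a = 0 ∧ c = 1 then P₀ else 0) + (if a = 1 ∧ c = 2 then P₁ else 0) + (if a = 2 ∧ c = 3 then P₂ else 0))
    (hCz : ∀ a b c : Fin 4, a ≠ b → a ≠ c → b ≠ c → α a b c (0, 0, 0) = 0)
    (ε₀ : ℝ) (X : Fin 4 → ℤ → ℝ → ℝ) (n : ℤ) (t : ℝ) :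
    quadTerm ε₀ α X 1 n t =
      P₀ * (1 + ε₀) ^ ((5 : ℝ) * n / 2) * X 0 n t ^ 2 -
        P₁ * (1 + ε₀) ^ ((5 : ℝ) * n / 2) * (X 1 n t * X 2 n t) := by
  rw [kpProper_quadTerm hs hc hO hD, pumpLadder_inShell hs hc hP hCz (fun j => X j n t) 1]
  simp [hw]
  ring

/-- **Ladder site `(2,n)`**: `quadTerm₂(n) = P₁Λₙx²_{1,n} − P₂Λₙx_{2,n}x_{3,n}`. [this file] -/
theorem pumpLadder_quadTerm_two (hs : IsSymmetricCoeff α) (hc : IsCancellingCoeff α)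
    (hO : ∀ (Y : Fin 4 → ℤ → ℝ → ℝ) (τ : ℝ), (∀ (j : Fin 4) (k : ℤ), 1 ≤ k → 0 ≤ Y j k τ) →
      ∀ δ : ℝ, 0 < δ → ∀ (i : Fin 4) (n : ℤ), 1 ≤ n → Y i n τ = 0 → 0 ≤ quadTerm δ α Y i n τ)
    (hD : ∀ a b i : Fin 4, a ≠ b → α a b i (0, 0, 1) = 0)
    (hw : ∀ a c : Fin 4, α a a c (0, 0, 1) = if a = 3 ∧ c = 0 then f else 0)
    (hP : ∀ a c : Fin 4, a ≠ c → α a a c (0, 0, 0) =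
      (if a = 0 ∧ c = 1 then P₀ else 0) + (if a = 1 ∧ c = 2 then P₁ else 0) + (if a = 2 ∧ c = 3 then P₂ else 0))
    (hCz : ∀ a b c : Fin 4, a ≠ b → a ≠ c → b ≠ c → α a b c (0, 0, 0) = 0)
    (ε₀ : ℝ) (X : Fin 4 → ℤ → ℝ → ℝ) (n : ℤ) (t : ℝ) :
    quadTerm ε₀ α X 2 n t =
      P₁ * (1 + ε₀) ^ ((5 : ℝ) * n / 2) * X 1 n t ^ 2 -
        P₂ * (1 + ε₀) ^ ((5 : ℝ) * n / 2) * (X 2 n t * X 3 n t) := by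
  rw [kpProper_quadTerm hs hc hO hD, pumpLadder_inShell hs hc hP hCz (fun j => X j n t) 2]
  simp [hw]
  ring

/-- **Ladder site `(3,n)`** (the only forward source): `quadTerm₃(n) = P₂Λₙx²_{2,n} − fΛₙx_{3,n}x_{0,n+1}`.
[this file] -/
theorem pumpLadder_quadTerm_three (hs : IsSymmetricCoeff α) (hc : IsCancellingCoeff α)
    (hO : ∀ (Y : Fin 4 → ℤ → ℝ → ℝ) (τ : ℝ), (∀ (j : Fin 4) (k : ℤ), 1 ≤ k → 0 ≤ Y j k τ) →
      ∀ δ : ℝ, 0 < δ → ∀ (i : Fin 4) (n : ℤ), 1 ≤ n → Y i n τ = 0 → 0 ≤ quadTerm δ α Y i n τ)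
    (hD : ∀ a b i : Fin 4, a ≠ b → α a b i (0, 0, 1) = 0)
    (hw : ∀ a c : Fin 4, α a a c (0, 0, 1) = if a = 3 ∧ c = 0 then f else 0)
    (hP : ∀ a c : Fin 4, a ≠ c → α a a c (0, 0, 0) =
      (if a = 0 ∧ c = 1 then P₀ else 0) + (if a = 1 ∧ c = 2 then P₁ else 0) + (if a = 2 ∧ c = 3 then P₂ else 0))
    (hCz : ∀ a b c : Fin 4, a ≠ b → a ≠ c → b ≠ c → α a b c (0, 0, 0) = 0)
    (ε₀ : ℝ) (X : Fin 4 → ℤ → ℝ → ℝ) (n : ℤ) (t : ℝ) :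
    quadTerm ε₀ α X 3 n t =
      P₂ * (1 + ε₀) ^ ((5 : ℝ) * n / 2) * X 2 n t ^ 2 -
        f * (1 + ε₀) ^ ((5 : ℝ) * n / 2) * (X 3 n t * X 0 (n + 1) t) := by
  rw [kpProper_quadTerm hs hc hO hD, pumpLadder_inShell hs hc hP hCz (fun j => X j n t) 3]
  simp [hw]
  ring

/-! ## §2 The ladder is a Katz–Pavlović chain along the sites `m = 4n + j` -/

/-- **The ladder's equations of motion are a positive Katz–Pavlović chain.**  Index the sites by
`(j, n) ↦ m = 4n + j` and let `w = (P₀, P₁, P₂, f)` and `c_{4n+j} := w_j Λₙ`.  Then for every site the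
nonlinearity is `c_{m-1}·z²_{m-1} − c_m·z_m·z_{m+1}`, where the predecessor of `(0, n)` is `(3, n-1)` and the
successor of `(3, n)` is `(0, n+1)`: this theorem lists the four cases with the SAME bond coefficient appearing as
the out-coefficient of a site and the in-coefficient of the next (a conservative nearest-neighbour chain with
one-signed bond fluxes `c_m z²_m z_{m+1}`). MODEL lattice algebra. [this file] -/
theorem pumpLadder_chain_step (hs : IsSymmetricCoeff α) (hc : IsCancellingCoeff α)
    (hO : ∀ (Y : Fin 4 → ℤ → ℝ → ℝ) (τ : ℝ), (∀ (j : Fin 4) (k : ℤ), 1 ≤ k → 0 ≤ Y j k τ) →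
      ∀ δ : ℝ, 0 < δ → ∀ (i : Fin 4) (n : ℤ), 1 ≤ n → Y i n τ = 0 → 0 ≤ quadTerm δ α Y i n τ)
    (hD : ∀ a b i : Fin 4, a ≠ b → α a b i (0, 0, 1) = 0)
    (hw : ∀ a c : Fin 4, α a a c (0, 0, 1) = if a = 3 ∧ c = 0 then f else 0)
    (hP : ∀ a c : Fin 4, a ≠ c → α a a c (0, 0, 0) =
      (if a = 0 ∧ c = 1 then P₀ else 0) + (if a = 1 ∧ c = 2 then P₁ else 0) + (if a = 2 ∧ c = 3 then P₂ else 0))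
    (hCz : ∀ a b c : Fin 4, a ≠ b → a ≠ c → b ≠ c → α a b c (0, 0, 0) = 0)
    (ε₀ : ℝ) (X : Fin 4 → ℤ → ℝ → ℝ) (n : ℤ) (t : ℝ) (c : ℤ → ℝ)
    (hc0 : ∀ k : ℤ, c (4 * k) = P₀ * (1 + ε₀) ^ ((5 : ℝ) * k / 2))
    (hc1 : ∀ k : ℤ, c (4 * k + 1) = P₁ * (1 + ε₀) ^ ((5 : ℝ) * k / 2))
    (hc2 : ∀ k : ℤ, c (4 * k + 2) = P₂ * (1 + ε₀) ^ ((5 : ℝ) * k / 2))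
    (hc3 : ∀ k : ℤ, c (4 * k + 3) = f * (1 + ε₀) ^ ((5 : ℝ) * k / 2)) :
    quadTerm ε₀ α X 0 n t = c (4 * (n - 1) + 3) * X 3 (n - 1) t ^ 2 - c (4 * n) * (X 0 n t * X 1 n t) ∧
    quadTerm ε₀ α X 1 n t = c (4 * n) * X 0 n t ^ 2 - c (4 * n + 1) * (X 1 n t * X 2 n t) ∧
    quadTerm ε₀ α X 2 n t = c (4 * n + 1) * X 1 n t ^ 2 - c (4 * n + 2) * (X 2 n t * X 3 n t) ∧
    quadTerm ε₀ α X 3 n t = c (4 * n + 2) * X 2 n t ^ 2 - c (4 * n + 3) * (X 3 n t * X 0 (n + 1) t) := by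
  refine ⟨?_, ?_, ?_, ?_⟩
  · rw [pumpLadder_quadTerm_zero hs hc hO hD hw hP hCz, hc3, hc0]
    push_cast
    ring_nf
  · rw [pumpLadder_quadTerm_one hs hc hO hD hw hP hCz, hc0, hc1]
  · rw [pumpLadder_quadTerm_two hs hc hO hD hw hP hCz, hc1, hc2]
  · rw [pumpLadder_quadTerm_three hs hc hO hD hw hP hCz, hc2, hc3]

/-- **The tuned ladder is the geometric chain at ratio `B = (1+ε₀)^{1/4}`.**  With `w_j = c₀·(1+ε₀)^{5j/8}`
(`j = 0,1,2,3`) the bond coefficient of site `m = 4n + j` is `w_j Λₙ = c₀·B^{5m/2}`, `B = (1+ε₀)^{1/4}` — the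
coefficient law `c₀ B^{5m/2}` of the standard Katz–Pavlović chain in Tao's normalisation at the scale ratio `B`.
[this file] -/
theorem pumpLadder_tuned_coeff {ε₀ : ℝ} (hε : -1 < ε₀) (c₀ : ℝ) (j : ℕ) (n : ℤ) :
    c₀ * (1 + ε₀) ^ ((5 : ℝ) * j / 8) * (1 + ε₀) ^ ((5 : ℝ) * n / 2) =
      c₀ * ((1 + ε₀) ^ ((1 : ℝ) / 4)) ^ ((5 : ℝ) * ((4 * n + j : ℤ) : ℝ) / 2) := by
  have hb : (0 : ℝ) < 1 + ε₀ := by linarith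
  rw [← Real.rpow_mul hb.le, mul_assoc, ← Real.rpow_add hb]
  congr 1
  congr 1
  push_cast
  ring

/-! ## §3 The grading lemma: a ladder mode `2` or `3` is primary -/

/-- **In every structural grading of a ladder table, mode `2` or mode `3` is primary.**  The structural clauses
are those of the registered stubs (`GradedStruct α lev`, skeleton v6–v19, verbatim): mode `3` is a forward source
(`α 3 3 0 (0,0,1) = f ≠ 0`); if `lev 3 ≠ 0`, its in-shell pump partner `2` (`α 2 2 3 (0,0,0) = P₂ ≠ 0`) must be of
level `0` or a forward source, and `2` feeds nothing. (The target clause likewise forces `lev 1 = 0` then; not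
recorded.) [this file] -/
theorem pumpLadder_primary_two_or_three
    (hw : ∀ a c : Fin 4, α a a c (0, 0, 1) = if a = 3 ∧ c = 0 then f else 0)
    (hP : ∀ a c : Fin 4, a ≠ c → α a a c (0, 0, 0) =
      (if a = 0 ∧ c = 1 then P₀ else 0) + (if a = 1 ∧ c = 2 then P₁ else 0) + (if a = 2 ∧ c = 3 then P₂ else 0))
    (hf : f ≠ 0) (hP₂ : P₂ ≠ 0) (lev : Fin 4 → ℕ)
    (hstruct : ∀ a, lev a ≠ 0 → (∃ e, α a a e (0, 0, 1) ≠ 0) →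
      (∀ j, α j j a (0, 0, 1) ≠ 0 → lev j < lev a ∧ (lev j = 0 ∨ ∃ e', α j j e' (0, 0, 1) ≠ 0)) ∧
      (∀ i₁ i₂, i₁ ≠ a → i₂ ≠ a → α i₁ i₂ a (0, 0, 0) ≠ 0 →
        (lev i₁ < lev a ∧ (lev i₁ = 0 ∨ ∃ e', α i₁ i₁ e' (0, 0, 1) ≠ 0)) ∧
        (lev i₂ < lev a ∧ (lev i₂ = 0 ∨ ∃ e', α i₂ i₂ e' (0, 0, 1) ≠ 0))) ∧
      (∃ e, α a a e (0, 0, 1) ≠ 0 ∧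
        (∀ j, α e e j (0, 0, 1) ≠ 0 → lev j < lev a ∧ (lev j = 0 ∨ ∃ e', α j j e' (0, 0, 1) ≠ 0)) ∧
        (∀ j, j ≠ e → α e e j (0, 0, 0) ≠ 0 →
          lev j < lev a ∧ (lev j = 0 ∨ ∃ e', α j j e' (0, 0, 1) ≠ 0)))) :
    lev 2 = 0 ∨ lev 3 = 0 := by
  by_cases h3 : lev 3 = 0
  · exact Or.inr h3
  · left
    have hsrc : ∃ e, α 3 3 e (0, 0, 1) ≠ 0 := ⟨0, by rw [hw]; simpa using hf⟩
    obtain ⟨_, h2, _⟩ := hstruct 3 h3 hsrc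
    have h223 : α 2 2 3 (0, 0, 0) ≠ 0 := by
      rw [hP 2 3 (by decide)]
      simpa using hP₂
    obtain ⟨⟨_, h2alt⟩, _⟩ := h2 2 2 (by decide) (by decide) h223
    rcases h2alt with h20 | ⟨e', he'⟩
    · exact h20
    · exact absurd (by rw [hw]; simp) he'

/-! ## §4 Primary graded barrier ⇒ super-critical chain barrier on a ladder mode -/

/-- **PRIMARY GRADED BARRIER ⇒ ν-UNIFORM SUPER-CRITICAL BARRIER FOR THE EMBEDDED CHAIN.**  If a ladder table
`α` (pumps `0→1→2→3`, feed `3→0`, weights `f ≠ 0`, `P₂ ≠ 0`) of `E₂(R)`, orthant with diagonal feeds, satisfies the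
body of the registered stubs' `PrimaryGradedAt R ε₀ α` (verbatim hypothesis `hPG`), then there are `θ ∈ (1/2, 1]`,
`D ≥ 0` and a ladder mode `j ∈ {2, 3}` such that, uniformly in `ν > 0`, along every honest non-negative viscous
solution from every one-shell datum, `(1+ε₀)^{2θn}·½x_{j,n}(t)² ≤ D·E₀` for all shells `n` — by §2 this is the
barrier `B^{8θn}·½z²_{4n+j} ≤ D·E₀`, `B = (1+ε₀)^{1/4}`, for the Katz–Pavlović chain the ladder embeds (tuned
weights: the geometric chain at ratio `B`), on the residue class `j (mod 4)` of its sites.  Hence the registered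
LARGE-ratio stub contains the λ-uniform chain barrier at every ratio `B ∈ ((5/4)^{1/4}, 2^{1/4}]`.
MODEL lattice bookkeeping; no stub is proved. [this file] -/
theorem pumpLadder_chainBarrier_of_primaryGraded {R ε₀ : ℝ}
    (hT : Literature.Analysis.FluidPDE.TaoCascade.InTableClass R α)
    (hO : ∀ (Y : Fin 4 → ℤ → ℝ → ℝ) (τ : ℝ), (∀ (j : Fin 4) (k : ℤ), 1 ≤ k → 0 ≤ Y j k τ) →
      ∀ δ : ℝ, 0 < δ → ∀ (i : Fin 4) (n : ℤ), 1 ≤ n → Y i n τ = 0 → 0 ≤ quadTerm δ α Y i n τ)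
    (hD : ∀ a b i : Fin 4, a ≠ b → α a b i (0, 0, 1) = 0)
    (hw : ∀ a c : Fin 4, α a a c (0, 0, 1) = if a = 3 ∧ c = 0 then f else 0)
    (hP : ∀ a c : Fin 4, a ≠ c → α a a c (0, 0, 0) =
      (if a = 0 ∧ c = 1 then P₀ else 0) + (if a = 1 ∧ c = 2 then P₁ else 0) + (if a = 2 ∧ c = 3 then P₂ else 0))
    (hf : f ≠ 0) (hP₂ : P₂ ≠ 0)
    (hPG : Literature.Analysis.FluidPDE.TaoCascade.InTableClass R α →
      (∀ (Y : Fin 4 → ℤ → ℝ → ℝ) (τ : ℝ), (∀ (j : Fin 4) (k : ℤ), 1 ≤ k → 0 ≤ Y j k τ) → ∀ δ : ℝ, 0 < δ →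
        ∀ (i : Fin 4) (n : ℤ), 1 ≤ n → Y i n τ = 0 → 0 ≤ Literature.Analysis.FluidPDE.TaoCascade.quadTerm δ α Y i n τ) →
      (∀ a b i : Fin 4, a ≠ b → α a b i (0, 0, 1) = 0) →
      ∃ (lev : Fin 4 → ℕ) (L : ℕ), (∀ a, lev a ≤ L) ∧
        (∀ a, lev a ≠ 0 → (∃ e, α a a e (0, 0, 1) ≠ 0) →
          (∀ j, α j j a (0, 0, 1) ≠ 0 → lev j < lev a ∧ (lev j = 0 ∨ ∃ e', α j j e' (0, 0, 1) ≠ 0)) ∧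
          (∀ i₁ i₂, i₁ ≠ a → i₂ ≠ a → α i₁ i₂ a (0, 0, 0) ≠ 0 →
            (lev i₁ < lev a ∧ (lev i₁ = 0 ∨ ∃ e', α i₁ i₁ e' (0, 0, 1) ≠ 0)) ∧
            (lev i₂ < lev a ∧ (lev i₂ = 0 ∨ ∃ e', α i₂ i₂ e' (0, 0, 1) ≠ 0))) ∧
          (∃ e, α a a e (0, 0, 1) ≠ 0 ∧
            (∀ j, α e e j (0, 0, 1) ≠ 0 → lev j < lev a ∧ (lev j = 0 ∨ ∃ e', α j j e' (0, 0, 1) ≠ 0)) ∧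
            (∀ j, j ≠ e → α e e j (0, 0, 0) ≠ 0 →
              lev j < lev a ∧ (lev j = 0 ∨ ∃ e', α j j e' (0, 0, 1) ≠ 0)))) ∧
        ∃ θ : ℝ, 1 / 2 < θ ∧ θ ≤ 1 ∧ ∃ D : ℝ, 0 ≤ D ∧
          ∀ ν : ℝ, 0 < ν → ∀ (X₀ : Fin 4 → ℝ) (s : ℝ), 0 < s → ∀ X : Fin 4 → ℤ → ℝ → ℝ,
          (∀ (i : Fin 4) (k : ℤ), X i k 0 = if k = 0 then X₀ i else 0) →
          (∀ (i : Fin 4) (k : ℤ), k < 0 → ∀ t : ℝ, X i k t = 0) →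
          (∃ M : ℝ, ∀ (t : ℝ) (i : Fin 4) (k : ℤ), (1 + (1 + ε₀) ^ ((10 : ℝ) * k)) * |X i k t| ≤ M) →
          (∀ (i : Fin 4) (k : ℤ), Continuous (X i k)) →
          (∀ (i : Fin 4) (k : ℤ), ∀ t ∈ Set.Icc (0 : ℝ) s, HasDerivWithinAt (X i k)
            (Literature.Analysis.FluidPDE.TaoCascade.quadTerm ε₀ α X i k t - ν * (1 + ε₀) ^ ((2 : ℝ) * k) * X i k t)
            (Set.Icc (0 : ℝ) s) t) →
          (∀ t ∈ Set.Icc (0 : ℝ) s, ∀ (i : Fin 4) (k : ℤ), 1 ≤ k → 0 ≤ X i k t) →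
          ∀ t ∈ Set.Icc (0 : ℝ) s, ∀ i, lev i = 0 → ∀ k : ℕ,
            (1 + ε₀) ^ (2 * θ * (k : ℝ)) * ((1 / 2 : ℝ) * X i (k : ℤ) t ^ 2) ≤
              D * (∑ j : Fin 4, (1 / 2 : ℝ) * X₀ j ^ 2)) :
    ∃ j : Fin 4, (j = 2 ∨ j = 3) ∧ ∃ θ : ℝ, 1 / 2 < θ ∧ θ ≤ 1 ∧ ∃ D : ℝ, 0 ≤ D ∧
      ∀ ν : ℝ, 0 < ν → ∀ (X₀ : Fin 4 → ℝ) (s : ℝ), 0 < s → ∀ X : Fin 4 → ℤ → ℝ → ℝ,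
      (∀ (i : Fin 4) (k : ℤ), X i k 0 = if k = 0 then X₀ i else 0) →
      (∀ (i : Fin 4) (k : ℤ), k < 0 → ∀ t : ℝ, X i k t = 0) →
      (∃ M : ℝ, ∀ (t : ℝ) (i : Fin 4) (k : ℤ), (1 + (1 + ε₀) ^ ((10 : ℝ) * k)) * |X i k t| ≤ M) →
      (∀ (i : Fin 4) (k : ℤ), Continuous (X i k)) →
      (∀ (i : Fin 4) (k : ℤ), ∀ t ∈ Set.Icc (0 : ℝ) s, HasDerivWithinAt (X i k)
        (Literature.Analysis.FluidPDE.TaoCascade.quadTerm ε₀ α X i k t - ν * (1 + ε₀) ^ ((2 : ℝ) * k) * X i k t)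
        (Set.Icc (0 : ℝ) s) t) →
      (∀ t ∈ Set.Icc (0 : ℝ) s, ∀ (i : Fin 4) (k : ℤ), 1 ≤ k → 0 ≤ X i k t) →
      ∀ t ∈ Set.Icc (0 : ℝ) s, ∀ k : ℕ,
        (1 + ε₀) ^ (2 * θ * (k : ℝ)) * ((1 / 2 : ℝ) * X j (k : ℤ) t ^ 2) ≤
          D * (∑ i : Fin 4, (1 / 2 : ℝ) * X₀ i ^ 2) := by
  obtain ⟨lev, _L, _hL, hstruct, θ, hθ, hθ1, D, hD, H⟩ := hPG hT hO hD
  have h23 := pumpLadder_primary_two_or_three hw hP hf hP₂ lev hstruct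
  rcases h23 with h2 | h3
  · refine ⟨2, Or.inl rfl, θ, hθ, hθ1, D, hD, ?_⟩
    intro ν hν X₀ s hs X hX0 hXneg hM hXc hXd hXpos t ht k
    exact H ν hν X₀ s hs X hX0 hXneg hM hXc hXd hXpos t ht 2 h2 k
  · refine ⟨3, Or.inr rfl, θ, hθ, hθ1, D, hD, ?_⟩
    intro ν hν X₀ s hs X hX0 hXneg hM hXc hXd hXpos t ht k
    exact H ν hν X₀ s hs X hX0 hXneg hM hXc hXd hXpos t ht 3 h3 k

end PumpLadder

end Summit.NavierStokesRegularity.NavierStokesRegularity.Theorems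

end
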